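import Mathlib
import HarnessLib
import Literature.AlgebraicGeometry.HodgeTheory.AtiyahClassCoherent

/-!
# The Atiyah class of the structure sheaf vanishes: `At′(𝒪_X) = 0` (the jet sequence of `𝒪_X` splits by `s ↦ (s, ds)`)

HONEST FRAMING: HELPER lemma `--supports stmt-HodgeConjecture-28148` (crux K2ᵀ, registered rung
`stub_rung_CMclass_d3 : KleimanAnchorRungCM 3`). It is ingredient (a) of THEOREM Σ of the crux workfile
`Cruxes/TwistNormalisedKleimanSemiregularAnchor/SIGMA-INVISIBLE-N8-rung1-g2.md` («classes of `Ext²(E,E)` that factor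
through `𝒪^m` are seen by the semiregularity map only through their trace»): the torsion-safe Atiyah class
`atiyahClass' F ∈ Ext¹(F, 𝓗om(𝒯, F))` of `HodgeTheory/AtiyahClassCoherent` (the class of the jet sequence
`0 → 𝓗om(𝒯_{X/S}, F) → P¹(F) → F → 0`) VANISHES for `F = 𝒪_X`: the universal derivation gives an `𝒪_X`-LINEAR
splitting `s ↦ (s, ds)` of `P¹(𝒪_X) → 𝒪_X` for the twisted module structure `a·(s, φ) = (as, aφ + s ⊗ da)`
(`a·(s, ds) = (as, a ds + s da) = (as, d(as))`, Leibniz), and a split short exact sequence has zero Yoneda class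
(`(𝟙).comp [S] = (σ ≫ g).comp [S] = σ.comp (g.comp [S]) = 0`, Mathlib `ShortExact.comp_extClass`). This is
Atiyah's «a holomorphic connection exists iff `b(E) = 0`» for the trivial line bundle, whose connection is `d`.
Nothing here constructs a seed or proves the rung, K2ᵀ, `WeilSixfolds`, HC_AV, HC_CM or HC. General mathematics
(any `S`-scheme); re-homable to `Literature/AlgebraicGeometry/HodgeTheory/` by its owners.

References: [Atiyah1957] §2 Thm. 2 and §4 (p. 193, `D(S)`, `b(E)`; Prop. 9: trivial bundle); [BuchweitzFlenner2003] §3;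
[Hartshorne1977] II.8.
-/

-- every declaration of this problem lives in `Summit.HodgeConjecture.HodgeConjecture.…` (summit = sub-problem)
set_option linter.dupNamespace false

noncomputable section

open CategoryTheory CategoryTheory.Abelian AlgebraicGeometry Opposite TopologicalSpace Limits

namespace Summit.HodgeConjecture.HodgeConjecture.Theorems

open Literature.AlgebraicGeometry.Modules Literature.AlgebraicGeometry.Motives
open Literature.AlgebraicGeometry.HodgeTheory

universe w u

variable {S : Type u} [CommRing S] {X : Over (Spec (CommRingCat.of S))}

/-- `δ′(a, s) = s · δ′(a, 1)` on the structure sheaf (`𝒪(U)`-linearity of `smulSection` in the section; the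
section `1 ∈ Γ(𝒪_X, U)` is the ring unit read in the unit module). [cite: Atiyah1957, §4 (p. 193)] -/
theorem deltaHomCoh_unit_eq_smul (U : X.left.Opens) (a s : Γ(X.left, U)) :
    deltaHomCoh (unitModule X.left) U a (show Γ(unitModule X.left, U) from s) =
      s • deltaHomCoh (unitModule X.left) U a (show Γ(unitModule X.left, U) from (1 : Γ(X.left, U))) := by
  have h1 : (show Γ(unitModule X.left, U) from s) =
      s • (show Γ(unitModule X.left, U) from (1 : Γ(X.left, U))) := (mul_one s).symm
  rw [deltaHomCoh, deltaHomCoh, ← comp_smul_overHom, ← smulSection_smul, ← h1]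

/-- Leibniz for the connection term: `δ′(as, 1) = a · δ′(s, 1) + δ′(a, s)` on `𝒪_X` — exactly the
`𝒪(U)`-linearity of `s ↦ (s, ds)` for the twisted module structure of `P¹(𝒪_X)`. [cite: Atiyah1957, §4 (p. 193)] -/
theorem deltaHomCoh_unit_mul (U : X.left.Opens) (a s : Γ(X.left, U)) :
    deltaHomCoh (unitModule X.left) U (a * s) (show Γ(unitModule X.left, U) from (1 : Γ(X.left, U))) =
      a • deltaHomCoh (unitModule X.left) U s (show Γ(unitModule X.left, U) from (1 : Γ(X.left, U))) +
        deltaHomCoh (unitModule X.left) U a (show Γ(unitModule X.left, U) from s) := by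
  rw [deltaHomCoh_unit_eq_smul U a s, deltaHomCoh, deltaHomCoh, deltaHomCoh, dSection_mul, evalAt_add,
    evalAt_smul, evalAt_smul, Preadditive.add_comp, smul_comp_overHom, smul_comp_overHom]

/-- `δ′` is additive in its first argument (on any module; re-derived from the public calculus). [folklore] -/
theorem deltaHomCoh_add_left' (E : X.left.Modules) (U : X.left.Opens) (a b : Γ(X.left, U)) (s : Γ(E, U)) :
    deltaHomCoh E U (a + b) s = deltaHomCoh E U a s + deltaHomCoh E U b s := by
  rw [deltaHomCoh, deltaHomCoh, deltaHomCoh, dSection_add, evalAt_add, Preadditive.add_comp]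

/-- `δ′(0, s) = 0`. [folklore] -/
theorem deltaHomCoh_zero_left' (E : X.left.Modules) (U : X.left.Opens) (s : Γ(E, U)) :
    deltaHomCoh E U 0 s = 0 := by
  have h := deltaHomCoh_add_left' E U 0 0 s
  rw [add_zero] at h
  exact left_eq_add.mp h

/-- `δ′` commutes with restriction (re-derived from the public calculus). [folklore] -/
theorem restrictHom_deltaHomCoh' (E : X.left.Modules) {U V : X.left.Opens} (i : V ⟶ U) (a : Γ(X.left, U))
    (s : Γ(E, U)) :
    restrictHom i (deltaHomCoh E U a s) =
      deltaHomCoh E V (X.left.presheaf.map i.op a) (E.presheaf.map i.op s) := by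
  rw [deltaHomCoh, deltaHomCoh, restrictHom_comp, restrictHom_evalAt, restrictHom_smulSection, map_dSection]

/-- The unit section restricts to the unit section. [folklore] -/
theorem unitModule_map_one {U V : X.left.Opens} (i : V ⟶ U) :
    (unitModule X.left).presheaf.map i.op (show Γ(unitModule X.left, U) from (1 : Γ(X.left, U))) =
      (show Γ(unitModule X.left, V) from (1 : Γ(X.left, V))) :=
  map_one (X.left.presheaf.map i.op).hom

/-- **The jet sequence of the structure sheaf splits**: there is an `𝒪_X`-linear section `σ : 𝒪_X → P¹(𝒪_X)`,
`s ↦ (s, ds)` (i.e. `(s, δ′(s, 1))`), of the projection `P¹(𝒪_X) → 𝒪_X` — the universal derivation `d` is a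
connection on the trivial line bundle. [cite: Atiyah1957, §2 Thm. 2 and §4] -/
theorem exists_splitting_jetπCoh_unitModule :
    ∃ σ : unitModule X.left ⟶ jetModuleCoh (unitModule X.left), σ ≫ jetπCoh (unitModule X.left) = 𝟙 _ := by
  refine ⟨⟨PresheafOfModules.homMk
      { app := fun U => AddCommGrpCat.ofHom
          { toFun := fun s : Γ(unitModule X.left, U.unop) =>
              (JetSectionsCoh.mk s (deltaHomCoh (unitModule X.left) U.unop (show Γ(X.left, U.unop) from s)
                (show Γ(unitModule X.left, U.unop) from (1 : Γ(X.left, U.unop)))) :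
                JetSectionsCoh (unitModule X.left) U.unop)
            map_zero' := Prod.ext rfl (deltaHomCoh_zero_left' (unitModule X.left) U.unop _)
            map_add' := fun s t => Prod.ext rfl (deltaHomCoh_add_left' (unitModule X.left) U.unop _ _ _) }
        naturality := fun {U V} i => by
          refine AddCommGrpCat.ext fun (s : Γ(unitModule X.left, U.unop)) => Prod.ext rfl ?_
          change deltaHomCoh (unitModule X.left) V.unop
              (show Γ(X.left, V.unop) from (unitModule X.left).presheaf.map i.unop.op s)
              (show Γ(unitModule X.left, V.unop) from (1 : Γ(X.left, V.unop))) =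
            restrictHom i.unop (deltaHomCoh (unitModule X.left) U.unop (show Γ(X.left, U.unop) from s)
              (show Γ(unitModule X.left, U.unop) from (1 : Γ(X.left, U.unop))))
          rw [restrictHom_deltaHomCoh', unitModule_map_one]
          rfl }
      (fun U (a : Γ(X.left, U.unop)) (s : Γ(unitModule X.left, U.unop)) => Prod.ext rfl (by
        change deltaHomCoh (unitModule X.left) U.unop (a * (show Γ(X.left, U.unop) from s))
            (show Γ(unitModule X.left, U.unop) from (1 : Γ(X.left, U.unop))) =
          a • deltaHomCoh (unitModule X.left) U.unop (show Γ(X.left, U.unop) from s)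
            (show Γ(unitModule X.left, U.unop) from (1 : Γ(X.left, U.unop))) +
          deltaHomCoh (unitModule X.left) U.unop a s
        exact deltaHomCoh_unit_mul U.unop a _))⟩, ?_⟩
  exact Scheme.Modules.hom_ext _ _ fun U => AddCommGrpCat.ext fun (s : Γ(unitModule X.left, U)) => rfl

variable [HasExt.{w} X.left.Modules]

/-- **`At′(𝒪_X) = 0`**: the torsion-safe Atiyah class of the structure sheaf of any `S`-scheme vanishes (the jet
sequence splits, `exists_splitting_jetπCoh_unitModule`; a split short exact sequence has zero class:
`[S] = (𝟙).comp [S] = (σ ≫ π).comp [S] = σ.comp (π.comp [S]) = 0`). [cite: Atiyah1957, §2 Thm. 2, Prop. 9] -/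
theorem atiyahClass'_unitModule_eq_zero : atiyahClass'.{w} (unitModule X.left) = 0 := by
  obtain ⟨σ, hσ⟩ := exists_splitting_jetπCoh_unitModule (X := X)
  have hS := jetShortComplexCoh_shortExact (unitModule X.left)
  have h1 : hS.extClass = (Ext.mk₀ (σ ≫ jetπCoh (unitModule X.left))).comp hS.extClass (zero_add 1) := by
    rw [hσ]
    exact (Ext.mk₀_id_comp hS.extClass).symm
  have h2 : (Ext.mk₀ (jetπCoh (unitModule X.left))).comp hS.extClass (zero_add 1) = 0 := hS.comp_extClass
  change hS.extClass = 0
  rw [h1, ← Ext.mk₀_comp_mk₀_assoc, h2]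
  exact Ext.comp_zero _ _ _ _ _

end Summit.HodgeConjecture.HodgeConjecture.Theorems

end
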